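import Mathlib
import Summits.ValiantsHypothesis.ValiantsHypothesis.Theorems.NewtonTauWeak.Negative.Zonogon
import Summits.ValiantsHypothesis.ValiantsHypothesis.Theorems.NewtonUnitEquationsNewtonTauWeakSumsetChartCount
import Summits.ValiantsHypothesis.ValiantsHypothesis.Theorems.NewtonUnitEquationsNewtonTauWeakMinkowskiVertexBoundOfChart
import Summits.ValiantsHypothesis.ValiantsHypothesis.Theorems.NewtonUnitEquationsNewtonTauWeakUnionVertexBound
import Summits.ValiantsHypothesis.ValiantsHypothesis.Theorems.NewtonUnitEquationsNewtonTauWeakLevelSetSplit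
import Summits.ValiantsHypothesis.ValiantsHypothesis.Theorems.NewtonUnitEquationsNewtonTauWeakLevelVertsHalving
import Summits.ValiantsHypothesis.ValiantsHypothesis.Theorems.NewtonUnitEquationsNewtonTauWeakLevelVertsRecursion
import Summits.ValiantsHypothesis.ValiantsHypothesis.Theorems.NewtonUnitEquationsNewtonTauWeakSquareRegime
import Summits.ValiantsHypothesis.ValiantsHypothesis.Theorems.NewtonUnitEquationsNewtonTauWeakGradedDesignT2

/-!
# `NewtonUnitEquationsNewtonTauWeakLevelVertsQuasi` — THEOREM W♯ (rung RungC7): the grade dependence of THEOREM W is quasi-polynomial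

(Second, independent route to the quasi-polynomial grade bound; the sibling file
`NewtonUnitEquationsNewtonTauWeakWeightedLevelSetQuasi.lean` — QUASI rung, `weightedLevelSetHull_kernelQuasi` — reached it first with
the constant `2(4c³+2)^k+2`; this file closes the registered RungC7 stubs of the lead-c7 skeleton.)

Line `binomial-normal-form` of crux `NewtonTauWeak` (stmt-ValiantsHypothesis-5904), lead c7, wave 1 composition (rung `RungC7` of
`Cruxes/NewtonTauWeak/Lines/binomial_normal_form.lean`, all six registered stubs landed: `stub_sumsetChartCount` p139031,
`stub_minkowskiVertexBoundOfChart` p139206, `stub_unionVertexBound` p138825, `stub_levelSetSplit` p138895,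
`stub_levelVertsHalving` p138903, `stub_levelVertsRecursion` p138921).

Setting.  `N` items with weights `g j ∈ [1, c]` and exponents `d j ∈ ℕ²` (coincidences allowed); the weighted level set
`X_v = {Σ_{j∈J} d j : Σ_{j∈J} g j = v}` and its hull-vertex count `LV = #ext conv(emb '' X_v)`.

* `levelVertsHalving` — GUSFIELD HALVING OVER THE ITEMS: `X_v(A ⊔ B) = ⋃_{v₁} X_{v₁}(A) ⊕ X_{v−v₁}(B)`, hull vertices of a finite
  union are at most the sum over the pieces, hull vertices of a planar Minkowski sum of finite sets are at most twice the sum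
  (chart lemma), so `LV(n₁+n₂) ≤ Σ_{v₁ ≤ c n₁} 2 (LV_A(v₁) + LV_B(v − v₁))` — unconditional.
* `levelVertsQuasi` — THEOREM W♯, item form: `LV ≤ (8cN+4)^{⌈log₂ N⌉}` for EVERY exponent list.
* `weightedLevelSetQuasi` — THEOREM W♯, grade form, through the landed kernel bootstrap `kernelBootstrap`
  (`V(N,c) ≤ (4N²+5)·V(4c²,c)`): `LV ≤ (4N²+5)·(32c³+4)^{⌈log₂(4c²)⌉}` — polynomial in `N`, QUASI-polynomial in the grade `c`
  (THEOREM W of lead c6 had `(2c+1)^{2c}`), for every exponent list.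
* `gradedDesignT2Quasi` — read as T2 on GRADED designs (`stub_gradedDesignT2OfHull`): on a dissociated exponent list, for ANY number
  `K` of products, nodes `u_l` and scalars, `vert(Σ_l cf_l Π_j (1 − u_l^{g_j} ρ_j X^{d_j})) ≤ (Σ_j g_j + 1)·(4N²+5)·(32c³+4)^{⌈log₂(4c²)⌉}`
  — uniform in `K`.

So any failure of polynomiality in the grade (the one-cell dichotomy H6 of the line) is confined to the window between `poly(c)` and
`c^{O(log c)}`.  Everything is folklore (Gusfield halving); no named facts, no citations, no `def`s.
-/

-- Sub = Summit single-conjunct layout: the duplicated namespace component is mandated by the tree.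
set_option linter.dupNamespace false

noncomputable section

open scoped BigOperators
open MvPolynomial
open Summit.ValiantsHypothesis.ValiantsHypothesis.Theorems.NewtonTauWeak.Negative (vert)

namespace Summit.ValiantsHypothesis.ValiantsHypothesis.Theorems.NewtonUnitEquationsNewtonTauWeak

/-- **The halving inequality, unconditional.**  For items `Fin (n₁ + n₂)` with weights in `[1, c]`,
`LV (n₁+n₂) g d v ≤ Σ_{v₁ ≤ c·n₁} 2·(LV n₁ g₁ d₁ v₁ + LV n₂ g₂ d₂ (v − v₁))` (blocks via `Fin.castAdd n₂` / `Fin.natAdd n₁`):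
`stub_levelVertsHalving` fed with the chart lemma + Minkowski bound (`stub_minkowskiVertexBoundOfChart ∘ stub_sumsetChartCount`), the
union bound (`stub_unionVertexBound`) and the split identity (`stub_levelSetSplit`). [folklore: Gusfield halving] -/
theorem levelVertsHalving (n₁ n₂ c v : ℕ) (g : Fin (n₁ + n₂) → ℕ) (hg : ∀ j, 1 ≤ g j ∧ g j ≤ c)
    (d : Fin (n₁ + n₂) → (Fin 2 →₀ ℕ)) :
    (Set.extremePoints ℝ (convexHull ℝ ((fun e : Fin 2 →₀ ℕ => fun i : Fin 2 => ((e i : ℕ) : ℝ)) ''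
      (((Finset.univ.filter fun J : Finset (Fin (n₁ + n₂)) => ∑ j ∈ J, g j = v).image
        fun J => ∑ j ∈ J, d j : Finset (Fin 2 →₀ ℕ)) : Set (Fin 2 →₀ ℕ))))).ncard ≤
      ∑ v₁ ∈ Finset.range (c * n₁ + 1), 2 *
        ((Set.extremePoints ℝ (convexHull ℝ ((fun e : Fin 2 →₀ ℕ => fun i : Fin 2 => ((e i : ℕ) : ℝ)) ''
          (((Finset.univ.filter fun J : Finset (Fin n₁) => ∑ j ∈ J, g (Fin.castAdd n₂ j) = v₁).image
            fun J => ∑ j ∈ J, d (Fin.castAdd n₂ j) : Finset (Fin 2 →₀ ℕ)) : Set (Fin 2 →₀ ℕ))))).ncard +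
        (Set.extremePoints ℝ (convexHull ℝ ((fun e : Fin 2 →₀ ℕ => fun i : Fin 2 => ((e i : ℕ) : ℝ)) ''
          (((Finset.univ.filter fun J : Finset (Fin n₂) => ∑ j ∈ J, g (Fin.natAdd n₁ j) = v - v₁).image
            fun J => ∑ j ∈ J, d (Fin.natAdd n₁ j) : Finset (Fin 2 →₀ ℕ)) : Set (Fin 2 →₀ ℕ))))).ncard) :=
  stub_levelVertsHalving n₁ n₂ c v g hg d
    (fun P Q => stub_minkowskiVertexBoundOfChart
      (fun σ hσ A B hA hB => stub_sumsetChartCount σ hσ A B hA hB) P Q)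
    (fun s S => stub_unionVertexBound s S) (fun n₁ n₂ v g d => stub_levelSetSplit n₁ n₂ v g d)

/-- **THEOREM W♯, item form:** `LV N g d v ≤ (8cN+4)^{⌈log₂ N⌉}` for weights in `[1, c]` and every exponent list
(`stub_levelVertsRecursion` applied to `levelVertsHalving`). [folklore: Gusfield halving] -/
theorem levelVertsQuasi (N c v : ℕ) (g : Fin N → ℕ) (hg : ∀ j, 1 ≤ g j ∧ g j ≤ c) (d : Fin N → (Fin 2 →₀ ℕ)) :
    (Set.extremePoints ℝ (convexHull ℝ ((fun e : Fin 2 →₀ ℕ => fun i : Fin 2 => ((e i : ℕ) : ℝ)) ''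
      (((Finset.univ.filter fun J : Finset (Fin N) => ∑ j ∈ J, g j = v).image
        fun J => ∑ j ∈ J, d j : Finset (Fin 2 →₀ ℕ)) : Set (Fin 2 →₀ ℕ))))).ncard ≤
      (8 * c * N + 4) ^ (Nat.clog 2 N) :=
  stub_levelVertsRecursion (fun n₁ n₂ c v g hg d => levelVertsHalving n₁ n₂ c v g hg d) N c v g hg d

/-- Arithmetic for the grade form: on `n ≤ 4c²` items the item-form bound is at most `(32c³+4)^{⌈log₂(4c²)⌉}`. [folklore] -/
theorem quasi_arith (n c : ℕ) (hn : n ≤ 4 * c * c) :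
    (8 * c * n + 4) ^ (Nat.clog 2 n) ≤ (32 * c * c * c + 4) ^ (Nat.clog 2 (4 * c * c)) := by
  have h1 : 8 * c * n + 4 ≤ 32 * c * c * c + 4 := by nlinarith [Nat.zero_le c]
  calc (8 * c * n + 4) ^ (Nat.clog 2 n) ≤ (32 * c * c * c + 4) ^ (Nat.clog 2 n) :=
        Nat.pow_le_pow_left h1 _
    _ ≤ (32 * c * c * c + 4) ^ (Nat.clog 2 (4 * c * c)) :=
        Nat.pow_le_pow_right (by omega) (Nat.clog_mono_right 2 hn)

/-- **THEOREM W♯, grade form.**  Hull vertices of a `ℤ`-weighted level set of subset sums on `N` items with weights in `[1, c]` are at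
most `(4N²+5)·(32c³+4)^{⌈log₂(4c²)⌉}` — polynomial in `N`, quasi-polynomial in the grade — for every exponent list: the landed kernel
bootstrap `kernelBootstrap` (`V(N,c) ≤ (4N²+5)·V(4c²,c)`) with `levelVertsQuasi` on the `≤ 4c²` kernel items. [folklore] -/
theorem weightedLevelSetQuasi (N c v : ℕ) (g : Fin N → ℕ) (hg : ∀ j, 1 ≤ g j ∧ g j ≤ c) (d : Fin N → (Fin 2 →₀ ℕ)) :
    (Set.extremePoints ℝ (convexHull ℝ ((fun e : Fin 2 →₀ ℕ => fun i : Fin 2 => ((e i : ℕ) : ℝ)) ''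
      (((Finset.univ.filter fun J : Finset (Fin N) => ∑ j ∈ J, g j = v).image
        fun J => ∑ j ∈ J, d j : Finset (Fin 2 →₀ ℕ)) : Set (Fin 2 →₀ ℕ))))).ncard ≤
      (4 * (N * N) + 5) * (32 * c * c * c + 4) ^ (Nat.clog 2 (4 * c * c)) :=
  kernelBootstrap N c v _ g hg d
    (fun n v' g' d' hn hg' => (levelVertsQuasi n c v' g' hg' d').trans (quasi_arith n c hn))

/-- **THEOREM W♯ read as T2 on GRADED designs, uniformly in `K`.**  On a dissociated exponent list, for ANY number `K` of products,
nodes `u_l` and scalars `cf_l`, and nonzero `ρ_j`: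
`vert(Σ_l cf_l Π_j (1 − u_l^{g_j} ρ_j X^{d_j})) ≤ (Σ_j g_j + 1)·(4N²+5)·(32c³+4)^{⌈log₂(4c²)⌉}` (`stub_gradedDesignT2OfHull` of lead c6
fed with `weightedLevelSetQuasi`). [folklore] -/
theorem gradedDesignT2Quasi (N c K : ℕ) (g : Fin N → ℕ) (hg : ∀ j, 1 ≤ g j ∧ g j ≤ c)
    (u cf : Fin K → ℂ) (ρ : Fin N → ℂ) (hρ : ∀ j, ρ j ≠ 0) (d : Fin N → (Fin 2 →₀ ℕ))
    (hdis : ∀ J J' : Finset (Fin N), ∑ j ∈ J, d j = ∑ j ∈ J', d j → J = J') :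
    vert (∑ l, C (cf l) * ∏ j, (1 - C (u l ^ g j * ρ j) * monomial (d j) 1)) ≤
      (∑ j, g j + 1) * ((4 * (N * N) + 5) * (32 * c * c * c + 4) ^ (Nat.clog 2 (4 * c * c))) :=
  stub_gradedDesignT2OfHull N K _ g u cf ρ hρ d hdis (fun v => weightedLevelSetQuasi N c v g hg d)

end Summit.ValiantsHypothesis.ValiantsHypothesis.Theorems.NewtonUnitEquationsNewtonTauWeak

end
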